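import Summits.CriticalPhenomena.PercolationContinuityZ3.Theorems.PercAnnulusCrossingIICClusterAtomsContractionProd
import Summits.CriticalPhenomena.PercolationContinuityZ3.Theorems.PercAnnulusCrossingIICTypicalScalesFat
import Summits.CriticalPhenomena.PercolationContinuityZ3.Theorems.PercAnnulusCrossingIICCondFatZd
import HarnessLib

/-!
# Typical scales of Kesten's IIC, II: thin shells have density at most `θ` — fat shells have positive lower density, a.s. (lane RSW3, p1 gen 20)

builds on p205010 (kernel theorem, internal audit signed; external expert review pending) — NOT used in this file
(only `p_c(ℤ^d) > 0`).

RSW3 lane (LANE 3 `prim-rsw3`), seat `prim-rsw3-p1` (gen 20).  Helper file (`--supports stmt-CriticalPhenomena-4575`);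
no definitions, no sorries.  Memo `run/shared/lean/prim/rsw3/P1-QM.md` §33.

Part I (`…IICTypicalScalesFat`) bounded the density of FAT shells from above via the mixed moments.  Here the density of THIN shells:
gen 17's conditional fatness `CF` (the shell count at scale `64sKb` is below `λσ` with conditional probability `≤ θ < 1` given the
inner cluster at scale `b` and the arm) iterated over an ARBITRARY finite set of scales (`…IICClusterAtomsContractionProd`) gives
`ν(⋂_{k∈I} thin_k) ≤ θ^{#I}`, and a SHARP form of the counting lemma turns this into an almost-sure density bound for every `ε > θ`:

* **`ae_eventually_card_filter_le_mul_of_lt`** — SHARP COUNTING LEMMA (any finite measure): if `ν(⋂_{i∈I} F_i) ≤ A q^{#I}` for all finite `I`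
  and `q < ε`, then **`ν`-a.s., for all large `k`, `#{i<k : F_i} ≤ εk`** (`t = (ε−q)/(2(q+1))`, `(1+t)^ε ≥ 1 + εt/(1+t)` from
  `log(1+t) ≥ 1 − (1+t)⁻¹`, so `(1+tq)/(1+t)^ε < 1`; Borel–Cantelli).  Part I's lemma needed `2q ≤ ε`; this is optimal (independent `F_i`);
* **`exists_iicMeasure_ae_density_thinShells_le_criticalProbI`** — at `p_c(ℤ^d)`, `d ≥ 2`, under (A2)□(s,L) + `CU⁺_l` + UAD: there are
  `K ≥ 1`, `λ > 0`, `θ < 1` (gen 17's CF constants) such that for every IIC probability measure `ν`, every `b₀ ≥ 1` and every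
  `ε > θ`, along the scales `b_k = b₀ρ^k`, `ρ = 64lsK`, with the shell counts `N_k = #{z ∈ Λ(64sKb_k) ∖ Λ(32sKb_k) : 0 ↔ z in Λ(b_{k+1})}`
  and levels `σ_k = λ(2·64sKb_k+1)^d π_{p_c}(64sKb_k)`: **`ν`-a.s., for all large `k`, `#{i<k : N_i < σ_i} ≤ εk`** — THIN SHELLS HAVE UPPER
  DENSITY AT MOST `θ`; FAT SHELLS (`N_i ≥ σ_i ≍ E N_i`) HAVE LOWER DENSITY AT LEAST `1 − θ > 0`, ALMOST SURELY.  The `ℤ^d` analogue of gen 16's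
  planar "positive density of good shells".
References: H. Kesten, Probab. Theory Relat. Fields 73 (1986) Thm. (8), §2; standard Chernoff counting.
-/

noncomputable section

namespace Summit.CriticalPhenomena.PercolationContinuityZ3.Theorems.Crossing

open MeasureTheory Filter Topology Literature.Probability.Percolation Literature.Probability.LatticeModels
open Literature.Probability.Percolation.DCT16
open Summit.CriticalPhenomena.PercolationContinuityZ3.Theorems.SurfaceTension

variable {d : ℕ}

/-! ## §1 The sharp counting lemma -/

section Counting

variable {Ω : Type*} [MeasurableSpace Ω]

/-- `(1+t)^ε ≥ 1 + ε·t/(1+t)` for `t ≥ 0`, `0 ≤ ε` (`(1+t)^ε = e^{ε log(1+t)} ≥ 1 + ε log(1+t)` and `log(1+t) ≥ 1 − (1+t)⁻¹`). [folklore] -/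
theorem one_add_mul_div_le_rpow {t ε : ℝ} (ht : 0 ≤ t) (hε : 0 ≤ ε) : 1 + ε * (t / (1 + t)) ≤ (1 + t) ^ ε := by
  have h1t : 0 < 1 + t := by linarith
  rw [Real.rpow_def_of_pos h1t]
  have hlog : t / (1 + t) ≤ Real.log (1 + t) := by
    have h := Real.one_sub_inv_le_log_of_pos h1t
    have heq : t / (1 + t) = 1 - (1 + t)⁻¹ := by field_simp; ring
    rw [heq]; exact h
  calc 1 + ε * (t / (1 + t)) ≤ 1 + ε * Real.log (1 + t) := by nlinarith
    _ = Real.log (1 + t) * ε + 1 := by ring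
    _ ≤ Real.exp (Real.log (1 + t) * ε) := Real.add_one_le_exp _

open Classical in
/-- **THE SHARP COUNTING LEMMA, ALMOST SURELY** (finite measure `ν`; `ν(⋂_{i∈I} F_i) ≤ A q^{#I}` for all finite `I`; `0 ≤ q < ε`):
**`ν`-a.s., for all large `k`, `#{i < k : F_i} ≤ ε·k`.**  Counting lemma of part I with `t = (ε−q)/(2(q+1))` and `m = ⌊εk⌋+1`:
`ν(N_k ≥ m) ≤ A((1+tq)/(1+t)^ε)^k` and `(1+tq)/(1+t)^ε < 1` since `(1+t)^ε ≥ 1 + εt/(1+t) > 1 + tq`; Borel–Cantelli.  Sharp: for independent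
`F_i` of probability `q` the density is `q`. [cite: Kesten1986, Thm. (8)] -/
theorem ae_eventually_card_filter_le_mul_of_lt (ν : Measure Ω) [IsFiniteMeasure ν] (F : ℕ → Set Ω)
    (hF : ∀ i, MeasurableSet (F i)) {A q ε : ℝ} (hA : 0 ≤ A) (hq : 0 ≤ q) (hqε : q < ε)
    (hprod : ∀ I : Finset ℕ, ν.real (⋂ i ∈ I, F i) ≤ A * q ^ I.card) :
    ∀ᵐ ω ∂ν, ∀ᶠ k : ℕ in atTop, ((((Finset.range k).filter fun i => ω ∈ F i).card : ℕ) : ℝ) ≤ ε * k := by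
  have hε : 0 < ε := lt_of_le_of_lt hq hqε
  -- the parameter `t` and the rate `r`
  set t : ℝ := (ε - q) / (2 * (q + 1)) with ht
  have ht0 : 0 < t := by rw [ht]; exact div_pos (by linarith) (by linarith)
  have h1t : 0 < 1 + t := by linarith
  have hbase : 0 < (1 + t) ^ ε := Real.rpow_pos_of_pos h1t ε
  set r : ℝ := (1 + t * q) / (1 + t) ^ ε with hr
  have hr0 : 0 ≤ r := div_nonneg (by nlinarith) hbase.le
  have hr1 : r < 1 := by
    rw [hr, div_lt_one hbase]
    have hlow := one_add_mul_div_le_rpow ht0.le hε.le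
    -- `t q < ε t/(1+t)` since `q(1+t) < ε`
    have hqt : q * (1 + t) < ε := by
      have h2q : 0 < 2 * (q + 1) := by linarith
      have hqt' : q * t * (2 * (q + 1)) = q * (ε - q) := by rw [ht, mul_assoc, div_mul_cancel₀ _ h2q.ne']
      have h3 : q * t * 2 * (q + 1) ≤ (ε - q) * (q + 1) := by nlinarith
      have h1 : q * t * 2 ≤ ε - q := le_of_mul_le_mul_right h3 (by linarith)
      nlinarith
    have hkey : t * q < ε * (t / (1 + t)) := by
      rw [show ε * (t / (1 + t)) = ε * t / (1 + t) by ring, lt_div_iff₀ h1t]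
      nlinarith
    linarith
  -- the exceptional events
  set S : ℕ → Set Ω := fun k => {ω : Ω | ⌊ε * k⌋₊ + 1 ≤ ((Finset.range k).filter fun i => ω ∈ F i).card} with hS
  have hle : ∀ k, ν (S k) ≤ ENNReal.ofReal (A * r ^ k) := fun k => by
    rw [← ENNReal.ofReal_toReal (measure_ne_top ν (S k))]
    refine ENNReal.ofReal_le_ofReal ?_
    have h1 := pow_mul_measureReal_le_card_filter_le ν F hF ht0.le hprod k (⌊ε * k⌋₊ + 1)
    have h2 : ((1 + t) ^ ε) ^ k ≤ (1 + t) ^ ((⌊ε * (k : ℝ)⌋₊ + 1 : ℕ) : ℝ) := by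
      rw [← Real.rpow_mul_natCast h1t.le]
      refine Real.rpow_le_rpow_of_exponent_le (by linarith) ?_
      have := Nat.lt_floor_add_one (ε * (k : ℝ))
      push_cast
      linarith
    rw [Real.rpow_natCast] at h2
    have hbk : 0 < ((1 + t) ^ ε) ^ k := pow_pos hbase k
    have h3 : ((1 + t) ^ ε) ^ k * ν.real (S k) ≤ A * (1 + t * q) ^ k :=
      calc ((1 + t) ^ ε) ^ k * ν.real (S k) ≤ (1 + t) ^ (⌊ε * (k : ℝ)⌋₊ + 1) * ν.real (S k) :=
            mul_le_mul_of_nonneg_right h2 measureReal_nonneg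
        _ ≤ A * (1 + t * q) ^ k := h1
    have hrk : r ^ k = (1 + t * q) ^ k / ((1 + t) ^ ε) ^ k := by rw [hr, div_pow]
    calc (ν (S k)).toReal = ν.real (S k) := rfl
      _ ≤ A * (1 + t * q) ^ k / ((1 + t) ^ ε) ^ k := by rw [le_div_iff₀ hbk, mul_comm]; exact h3
      _ = A * r ^ k := by rw [hrk, mul_div_assoc]
  have hsum : (∑' k, ν (S k)) ≠ ⊤ := by
    have hgeom : Summable fun k : ℕ => A * r ^ k := (summable_geometric_of_lt_one hr0 hr1).mul_left A
    have hfin : (∑' k, ENNReal.ofReal (A * r ^ k)) ≠ ⊤ := by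
      rw [← ENNReal.ofReal_tsum_of_nonneg (fun k => mul_nonneg hA (pow_nonneg hr0 k)) hgeom]
      exact ENNReal.ofReal_ne_top
    exact ne_top_of_le_ne_top hfin (ENNReal.tsum_le_tsum hle)
  filter_upwards [ae_eventually_notMem hsum] with ω hω
  refine hω.mono fun k hk => ?_
  simp only [hS, Set.mem_setOf_eq, not_le] at hk
  have hk' : ((Finset.range k).filter fun i => ω ∈ F i).card ≤ ⌊ε * (k : ℝ)⌋₊ := by omega
  calc ((((Finset.range k).filter fun i => ω ∈ F i).card : ℕ) : ℝ) ≤ (⌊ε * (k : ℝ)⌋₊ : ℝ) := by exact_mod_cast hk'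
    _ ≤ ε * k := Nat.floor_le (by positivity)

end Counting

/-! ## §2 The density of thin shells of the IIC -/

open Classical in
/-- **THIN SHELLS OF KESTEN'S IIC HAVE UPPER DENSITY AT MOST `θ`; FAT SHELLS HAVE POSITIVE LOWER DENSITY, ALMOST SURELY** (`p_c(ℤ^d)`, `d ≥ 2`;
(A2)□ at aspect `(s,L)`, `2 ≤ s ≤ L`, `ϰ > 0`; `CU⁺_l(c_U)`, `l ≥ 2`, `c_U > 0`; UAD).  There are `K ≥ 1`, `λ > 0` and `θ < 1` such that for every
IIC probability measure `ν`, every `b₀ ≥ 1` and every `ε > θ`, along the scales `b_k = b₀ρ^k` (`ρ = 64lsK`), with the shell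
counts `N_k = #{z ∈ Λ(64sKb_k) ∖ Λ(32sKb_k) : 0 ↔ z in Λ(b_{k+1})}` and the levels `σ_k = λ·(2·64sKb_k + 1)^d·π_{p_c}(64sKb_k)`:
**`ν`-almost surely, for all large `k`, `#{i < k : N_i < σ_i} ≤ ε·k`.**  (Gen 17's conditional fatness iterated over the thin scales:
`ν(⋂_{i∈I}{N_i < σ_i}) ≤ θ^{#I}` for every finite `I`; then the sharp counting lemma.) [cite: Kesten1986, Thm. (8)] [cite: BasuSapozhnikov2017ECP, Thm. 1.1] -/
theorem exists_iicMeasure_ae_density_thinShells_le_criticalProbI (hd : 2 ≤ d) {s L : ℕ} (hs : 2 ≤ s) (hsL : s ≤ L)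
    {ϰ : ℝ} (hϰ : 0 < ϰ) (hA2 : SetToSetQuasiMultAspectAt d (criticalProbI d) s L ϰ) {l : ℕ} (hl : 2 ≤ l) {cU : ℝ} (hcU : 0 < cU)
    (hCU : ∀ a : ℕ, 1 ≤ a → ∀ E : Set (BondConfig (Site d)), IsUpperSet E → MeasurableSet E →
      cU * (bondPercolation (zdGraph d) (criticalProbI d)).real E ≤ (bondPercolation (zdGraph d) (criticalProbI d)).real (E ∩
        {ω : BondConfig (Site d) | ∀ t ∈ innerBoundary (zdGraph d) (box d a), ∀ s ∈ innerBoundary (zdGraph d) (box d (l * a)),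
          ∀ t' ∈ innerBoundary (zdGraph d) (box d a), ∀ s' ∈ innerBoundary (zdGraph d) (box d (l * a)),
          ω ∈ openConnIn (↑((box d (l * a) \ box d a) ∪ innerBoundary (zdGraph d) (box d a)) : Set (Site d)) t s →
          ω ∈ openConnIn (↑((box d (l * a) \ box d a) ∪ innerBoundary (zdGraph d) (box d a)) : Set (Site d)) t' s' →
          ω ∈ openConnIn (↑((box d (l * a) \ box d a) ∪ innerBoundary (zdGraph d) (box d a)) : Set (Site d)) s s'}))
    (hUAD : ∀ ε : ℝ, 0 < ε → ∃ K₀ : ℕ, ∀ m : ℕ, 1 ≤ m → ∀ N : ℕ, K₀ * m ≤ N →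
      (bondPercolation (zdGraph d) (criticalProbI d)).real (boxCrossing d m N) ≤ ε) :
    ∃ (K : ℕ) (lam θ : ℝ), 1 ≤ K ∧ 0 < lam ∧ θ < 1 ∧ ∀ (ν : Measure (BondConfig (Site d))) [IsProbabilityMeasure ν],
      (∀ (F : Finset (Sym2 (Site d))) (E : Set (BondConfig (Site d))), MeasurableSet E → DeterminedBy E ↑F →
        Tendsto (fun n : ℕ => (bondPercolation (zdGraph d) (criticalProbI d)).real (E ∩ siteToBoundary d n) /
          oneArmProb d (criticalProbI d) n) atTop (𝓝 (ν.real E))) →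
      ∀ (b₀ : ℕ), 1 ≤ b₀ → ∀ (ε : ℝ), θ < ε →
        ∀ᵐ ω ∂ν, ∀ᶠ k : ℕ in atTop,
          ((((Finset.range k).filter fun i =>
              (((box d (64 * (s * K * (b₀ * (64 * l * s * K) ^ i))) \ box d (32 * (s * K * (b₀ * (64 * l * s * K) ^ i)))).filter
                  fun z => ω ∈ (openConnIn (↑(box d (b₀ * (64 * l * s * K) ^ (i + 1))) : Set (Site d)) (0 : Site d) z :
                    Set (BondConfig (Site d)))).card : ℝ) <
                lam * (2 * ((64 * s * K * (b₀ * (64 * l * s * K) ^ i) : ℕ) : ℝ) + 1) ^ d *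
                  oneArmProb d (criticalProbI d) (64 * s * K * (b₀ * (64 * l * s * K) ^ i))).card : ℕ) : ℝ) ≤ ε * k := by
  have hd1 : 1 ≤ d := le_trans (by norm_num) hd
  have hp : 0 < ((criticalProbI d : unitInterval) : ℝ) := by
    rw [coe_criticalProbI]; exact criticalProb_zd_pos d hd1
  obtain ⟨K, lam, θ, hK, hlam, hθhalf, hθ1, hCF⟩ := exists_condFat_criticalProbI hd hs hsL hϰ hA2 hl hcU hCU hUAD
  have hθ0 : 0 ≤ θ := by linarith
  refine ⟨K, lam, θ, hK, hlam, hθ1, fun ν _ hν b₀ hb₀ ε hθε => ?_⟩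
  -- the scales
  set ρ : ℕ := 64 * l * s * K with hρ
  have hρ3 : 3 ≤ ρ := by
    rw [hρ]
    calc 3 ≤ 64 * 1 * 1 * 1 := by norm_num
      _ ≤ 64 * l * s * K := Nat.mul_le_mul (Nat.mul_le_mul (Nat.mul_le_mul_left 64 (by omega)) (by omega)) hK
  set m : ℕ → ℕ := fun k => b₀ * ρ ^ k with hm
  have hm1 : ∀ k, 1 ≤ m k := fun k => Nat.one_le_iff_ne_zero.2 (by positivity)
  have hmgap : ∀ k, m k + 1 < m (k + 1) := by
    intro k
    have h2 : m (k + 1) = m k * ρ := by simp only [hm, pow_succ]; ring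
    have h3 : m k * 3 ≤ m k * ρ := Nat.mul_le_mul_left _ hρ3
    have := hm1 k
    omega
  -- the pair sets and rims
  set F : ℕ → Finset (Site d) → Finset (Sym2 (Site d)) := fun k V =>
    (V ×ˢ (box d (m k) \ V)).image fun q => s(q.1, q.2) with hFdef
  set Kf : ℕ → Finset (Site d) → Finset (Sym2 (Site d)) := fun k V =>
    (V ×ˢ box d (m k + 1)).image fun q => s(q.1, q.2) with hKdef
  set Y : ℕ → Finset (Site d) → Finset (Sym2 (Site d)) → Finset (Site d) := fun k V η =>
    (box d (m k + 1) \ box d (m k)).filter fun y => ∃ x ∈ V, s(x, y) ∈ η ∧ (zdGraph d).Adj x y with hYdef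
  have hF : ∀ k V e, e ∈ F k V ↔ ∃ x ∈ V, ∃ y ∈ box d (m k), y ∉ V ∧ e = s(x, y) := by
    intro k V e
    simp only [hFdef, Finset.mem_image, Finset.mem_product, Finset.mem_sdiff, Prod.exists]
    constructor
    · rintro ⟨x, y, ⟨hx, hy, hyV⟩, rfl⟩; exact ⟨x, hx, y, hy, hyV, rfl⟩
    · rintro ⟨x, hx, y, hy, hyV, rfl⟩; exact ⟨x, y, ⟨hx, hy, hyV⟩, rfl⟩
  have hKf : ∀ k V e, e ∈ Kf k V ↔ ∃ x ∈ V, ∃ y ∈ box d (m k + 1), e = s(x, y) := by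
    intro k V e
    simp only [hKdef, Finset.mem_image, Finset.mem_product, Prod.exists]
    constructor
    · rintro ⟨x, y, ⟨hx, hy⟩, rfl⟩; exact ⟨x, hx, y, hy, rfl⟩
    · rintro ⟨x, hx, y, hy, rfl⟩; exact ⟨x, y, ⟨hx, hy⟩, rfl⟩
  have hY : ∀ k V η y, y ∈ Y k V η ↔ y ∈ box d (m k + 1) ∧ y ∉ box d (m k) ∧ ∃ x ∈ V, s(x, y) ∈ η ∧ (zdGraph d).Adj x y := by
    intro k V η y
    rw [hYdef, Finset.mem_filter, Finset.mem_sdiff, and_assoc]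
  -- count sets and thresholds
  set Q : ℕ → Finset (Site d) := fun k => box d (64 * (s * K * m k)) \ box d (32 * (s * K * m k)) with hQ
  set t : ℕ → ℝ := fun k => lam * (2 * ((64 * s * K * m k : ℕ) : ℝ) + 1) ^ d * oneArmProb d (criticalProbI d) (64 * s * K * m k)
    with ht
  set Thin : ℕ → Set (BondConfig (Site d)) := fun k => {ω : BondConfig (Site d) | (((Q k).filter fun z =>
    ω ∈ (openConnIn (↑(box d (m (k + 1))) : Set (Site d)) (0 : Site d) z : Set (BondConfig (Site d)))).card : ℝ) < t k} with hThin
  have hThinm : ∀ k, MeasurableSet (Thin k) := fun k =>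
    measurableSet_setOf_card_filter_lt _ _ (fun z _ => measurableSet_openConnIn _ _ _) _
  -- the product bound on every finite set of scales
  have hprod : ∀ I : Finset ℕ, ν.real (⋂ k ∈ I, Thin k) ≤ 1 * θ ^ I.card := by
    intro I
    set j : ℕ := I.sup id + 1 with hj
    have hIj : I ⊆ Finset.range j := fun k hk => Finset.mem_range.2 (Nat.lt_succ_of_le (Finset.le_sup (f := id) hk))
    set Nf : ℕ → ℕ := fun k => (L * (16 * K) + 81 * (s * K) + l * (64 * (s * K))) * m k + 2 with hNf
    set N : ℕ := I.sup Nf with hN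
    have hCF' : ∀ n, N ≤ n → ∀ k ∈ I, ∀ V : Finset (Site d), V ⊆ box d (m k) → (0 : Site d) ∈ V →
        ∀ η : Finset (Sym2 (Site d)), η ⊆ Kf k V →
        (bondPercolation (zdGraph d) (criticalProbI d)).real
            ({ω : BondConfig (Site d) | (((Q k).filter fun z =>
                ω ∈ openCrossing (↑(box d (m (k + 1)) \ V) : Set (Site d)) {z} ↑(Y k V η)).card : ℝ) < t k} ∩
              {ω : BondConfig (Site d) | ∃ y ∈ Y k V η, ∃ s' ∈ innerBoundary (zdGraph d) (box d n),
                ω ∈ openConnIn ((↑(box d n) : Set (Site d)) \ ↑V) y s'}) ≤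
          θ * (bondPercolation (zdGraph d) (criticalProbI d)).real {ω : BondConfig (Site d) | ∃ y ∈ Y k V η,
            ∃ s' ∈ innerBoundary (zdGraph d) (box d n), ω ∈ openConnIn ((↑(box d n) : Set (Site d)) \ ↑V) y s'} := by
      intro n hn k hk V hVm h0 η _
      have hNk : Nf k ≤ n := le_trans (Finset.le_sup (f := Nf) hk) hn
      have hYsub : Y k V η ⊆ box d (1 * m k + 1) \ box d (1 * m k) := by
        intro y hy; rw [one_mul, Finset.mem_sdiff]; exact ⟨((hY k V η y).1 hy).1, ((hY k V η y).1 hy).2.1⟩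
      have hreg : box d (m (k + 1)) = box d (1 * (64 * l * s * K) * m k) := by
        congr 1; simp only [hm, hρ, pow_succ]; ring
      have h := hCF (m k) (hm1 k) V (by rw [one_mul]; exact hVm) h0 (Y k V η) hYsub n hNk
      rw [← hreg] at h
      exact h
    have h := iicMeasure_real_biInter_filter_le_pow hd1 (criticalProbI d) hp m hmgap Q t hθ0 F Kf hF hKf Y hY j N I hIj
      hCF' hν
    rw [probReal_univ, mul_one] at h
    rw [one_mul]
    exact h
  -- the sharp counting lemma
  have h := ae_eventually_card_filter_le_mul_of_lt ν Thin hThinm zero_le_one hθ0 hθε hprod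
  filter_upwards [h] with ω hω
  refine hω.mono fun k hk => ?_
  simpa only [hThin, hQ, ht, hm, hρ, Set.mem_setOf_eq] using hk

end Summit.CriticalPhenomena.PercolationContinuityZ3.Theorems.Crossing

end
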